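import Mathlib
import Literature.Computability.Complexity.OccurrenceObstructionsIPProofs

/-!
# `ValuativeGCT.ValuativeFlip` (stmt-ValiantsHypothesis-12624): BIP's padding twist is polynomial in the
# padding — size-transfer axis, part Va (the core of eventual inheritance)

Crux `ValuativeFlip` of route `ValuativeGCT`; wall-breaker k12/16, 2026-08-16.  The Kadish–Landsberg/BIP lift
evaluates a lifted highest-weight vector at a padded point `X_top^j · ι(f)` as `F(Δ_j f)`, `Δ_j` rescaling the
coefficient of `x^e` by `(e_top + j)!/e_top!` (`aeval_formCoeff_paddedForm_liftHWV`).  This file isolates the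
target-independent algebra that makes the twist harmless for all but finitely many `j`:

* `factorial_mul_eval_twistPoly` — `(e + j)!/e! = j! · w_e(j)` with `w_e(t) = (t+1)(t+2)⋯(t+e)/e!`;
* `exists_twistPolyMatrix` — for forms `F_i` of degree `δ` on the degree-`n` coefficient space and ANY points
  `q_l`, the Δ_j-twisted evaluation matrix is `(j!)^δ ·` (one matrix over `ℂ[t]`, entries of degree `≤ δ·n`,
  specialised at `t = j`), untwisted at `t = 0` (`natDegree_aeval_le_of_isHomogeneous`);
* `twistedDet_ne_zero_cofinite` / `twistedDet_ne_zero_eventually` — so a NONSINGULAR untwisted matrix stays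
  nonsingular after twisting for all `j` off at most `D·nδ` natural numbers (`natDegree_det_le_of_forall_le`,
  `Polynomial.card_roots'`).

Consumers: `…EventualInheritance` (per side, BLMW Problem 6.10 "≥" eventually, over the landed
`stub_twistedInheritance`) and `…DetEventualMonotone` (det side).  Sources: Bürgisser–Ikenmeyer–Panova 2019
Lemma 5.2; BLMW 2011 §6.4 Problem 6.10; folklore.
-/

set_option linter.dupNamespace false

namespace Summit.ValiantsHypothesis.ValiantsHypothesis.Theorems.ValuativeFlip

open scoped BigOperators
open MvPolynomial
open Literature.NumberTheory.DiophantineGeometry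
open Literature.Computability.AlgebraicComplexity
open Literature.Computability.Complexity

noncomputable section

/-! ## The twist is polynomial in the padding -/

/-- The polynomial `w_e(t) = (t+1)(t+2)⋯(t+e)/e!`, whose value at `t = j` carries BIP's twist:
`j! · w_e(j) = (e + j)!/e!`. [Bürgisser–Ikenmeyer–Panova 2019 Lemma 5.2] -/
theorem factorial_mul_eval_twistPoly (e j : ℕ) :
    ((j.factorial : ℕ) : ℂ) * Polynomial.eval (j : ℂ)
        (Polynomial.C ((e.factorial : ℂ)⁻¹) * ∏ i ∈ Finset.range e, (Polynomial.X + Polynomial.C ((i : ℂ) + 1))) =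
      (((e + j).descFactorial j : ℕ) : ℂ) := by
  rw [Polynomial.eval_mul, Polynomial.eval_C, Polynomial.eval_prod]
  simp only [Polynomial.eval_add, Polynomial.eval_X, Polynomial.eval_C]
  -- `∏_{i<e} (j + i + 1) = (j+1).ascFactorial e` and `j! · (j+1).ascFactorial e = (j + e)!`
  have hprod : ∏ i ∈ Finset.range e, ((j : ℂ) + ((i : ℂ) + 1)) = (((j + 1).ascFactorial e : ℕ) : ℂ) := by
    rw [Nat.ascFactorial_eq_prod_range]
    push_cast
    refine Finset.prod_congr rfl fun i _ => by ring
  have hfac : ((j.factorial : ℕ) : ℂ) * (((j + 1).ascFactorial e : ℕ) : ℂ) = (((j + e).factorial : ℕ) : ℂ) := by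
    rw [← Nat.cast_mul, Nat.factorial_mul_ascFactorial]
  have hdesc : (((e + j).descFactorial j : ℕ) : ℂ) * ((e.factorial : ℕ) : ℂ) = (((e + j).factorial : ℕ) : ℂ) := by
    rw [← Nat.cast_mul]
    congr 1
    have h := Nat.factorial_mul_descFactorial (Nat.le_add_left j e)
    rw [Nat.add_sub_cancel] at h
    rw [mul_comm]
    exact h
  have he : ((e.factorial : ℕ) : ℂ) ≠ 0 := Nat.cast_ne_zero.2 (Nat.factorial_ne_zero e)
  rw [hprod]
  have hd : (((e + j).descFactorial j : ℕ) : ℂ) = ((j.factorial : ℕ) : ℂ) * (((j + 1).ascFactorial e : ℕ) : ℂ) *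
      ((e.factorial : ℕ) : ℂ)⁻¹ := by
    rw [hfac, eq_mul_inv_iff_mul_eq₀ he, hdesc, Nat.add_comm]
  rw [hd]
  ring

/-- Degree bound for a polynomial-valued evaluation of a form: if every variable goes to a polynomial of
degree `≤ B`, a form of degree `δ` goes to a polynomial of degree `≤ δ·B`. [folklore] -/
theorem natDegree_aeval_le_of_isHomogeneous {ι : Type*} {F : MvPolynomial ι ℂ} {δ B : ℕ}
    (hF : F.IsHomogeneous δ) (g : ι → Polynomial ℂ) (hg : ∀ e, (g e).natDegree ≤ B) :
    (MvPolynomial.aeval g F).natDegree ≤ δ * B := by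
  classical
  rw [F.as_sum, map_sum]
  refine Polynomial.natDegree_sum_le_of_forall_le _ _ fun s hs => ?_
  rw [MvPolynomial.aeval_monomial]
  refine (Polynomial.natDegree_C_mul_le _ _).trans ?_
  rw [Finsupp.prod]
  refine (Polynomial.natDegree_prod_le _ _).trans ?_
  have hdeg : ∑ e ∈ s.support, s e = δ := by
    have h := hF (MvPolynomial.mem_support_iff.mp hs)
    simpa [Finsupp.weight_apply, Finsupp.sum] using h
  calc ∑ e ∈ s.support, (g e ^ s e).natDegree
      ≤ ∑ e ∈ s.support, s e * B := Finset.sum_le_sum fun e _ =>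
          (Polynomial.natDegree_pow_le).trans (Nat.mul_le_mul_left _ (hg e))
    _ = (∑ e ∈ s.support, s e) * B := by rw [Finset.sum_mul]
    _ = δ * B := by rw [hdeg]

/-- Degree bound for a determinant of polynomials: entries of degree `≤ B` give `deg det ≤ D·B`. [folklore] -/
theorem natDegree_det_le_of_forall_le {D B : ℕ} (M : Matrix (Fin D) (Fin D) (Polynomial ℂ))
    (h : ∀ i l, (M i l).natDegree ≤ B) : M.det.natDegree ≤ D * B := by
  classical
  rw [Matrix.det_apply]
  refine Polynomial.natDegree_sum_le_of_forall_le _ _ fun σ _ => ?_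
  rw [Units.smul_def, zsmul_eq_mul]
  refine (Polynomial.natDegree_mul_le).trans ?_
  have hint : ((((σ.sign : ℤˣ) : ℤ) : Polynomial ℂ)).natDegree = 0 := Polynomial.natDegree_intCast _
  rw [hint, zero_add]
  refine (Polynomial.natDegree_prod_le _ _).trans ?_
  calc ∑ i, (M (σ i) i).natDegree ≤ ∑ _i : Fin D, B := Finset.sum_le_sum fun i _ => h _ _
    _ = D * B := by simp

/-- **The twist is polynomial in the padding.**  For forms `F_i` of degree `δ` on the degree-`n` coefficient
space and arbitrary degree-`n` forms `q_l` (the points), there is ONE matrix `P` over `ℂ[t]`, with entries of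
degree `≤ δ·n`, such that for every `j` the Δ_j-twisted evaluation matrix
`(F_i((((e_top + j)!/e_top!) · coeff_e q_l)_e))_{i,l}` is `(j!)^δ · P(j)`.  (At `j = 0` the twist is trivial, so
`P(0)` is the untwisted evaluation matrix.) [Bürgisser–Ikenmeyer–Panova 2019 Lemma 5.2; this crux] -/
theorem exists_twistPolyMatrix (n : ℕ) [NeZero n] {δ D : ℕ} (F : Fin D → MvPolynomial (DegIdx (MatIdx n) n) ℂ)
    (hhom : ∀ i, (F i).IsHomogeneous δ) (q : Fin D → MvPolynomial (MatIdx n) ℂ) :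
    ∃ P : Matrix (Fin D) (Fin D) (Polynomial ℂ),
      (∀ j : ℕ, (Matrix.of fun i l : Fin D => MvPolynomial.aeval
          (fun e : DegIdx (MatIdx n) n => (((e.1 (topMatIdx n) + j).descFactorial j : ℕ) : ℂ) *
            MvPolynomial.coeff e.1 (q l)) (F i)) = ((j.factorial : ℂ) ^ δ) • P.map (Polynomial.eval (j : ℂ))) ∧
      ∀ i l, (P i l).natDegree ≤ δ * n := by
  classical
  let w : ℕ → Polynomial ℂ := fun e =>
    Polynomial.C ((e.factorial : ℂ)⁻¹) * ∏ i ∈ Finset.range e, (Polynomial.X + Polynomial.C ((i : ℂ) + 1))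
  let P : Matrix (Fin D) (Fin D) (Polynomial ℂ) := Matrix.of fun i l =>
    MvPolynomial.aeval (fun e : DegIdx (MatIdx n) n => w (e.1 (topMatIdx n)) * Polynomial.C (coeff e.1 (q l))) (F i)
  refine ⟨P, fun j => ?_, fun i l => ?_⟩
  · ext i l
    simp only [P, Matrix.smul_apply, Matrix.map_apply, Matrix.of_apply, smul_eq_mul]
    -- evaluation at `t = j` commutes with `aeval`
    have hcomp : Polynomial.eval (j : ℂ) (MvPolynomial.aeval
          (fun e : DegIdx (MatIdx n) n => w (e.1 (topMatIdx n)) * Polynomial.C (coeff e.1 (q l))) (F i)) =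
        MvPolynomial.aeval (fun e : DegIdx (MatIdx n) n =>
          Polynomial.eval (j : ℂ) (w (e.1 (topMatIdx n))) * coeff e.1 (q l)) (F i) := by
      have H : (Polynomial.aeval (R := ℂ) (j : ℂ)).comp (MvPolynomial.aeval
            (fun e : DegIdx (MatIdx n) n => w (e.1 (topMatIdx n)) * Polynomial.C (coeff e.1 (q l)))) =
          MvPolynomial.aeval (fun e : DegIdx (MatIdx n) n =>
            Polynomial.eval (j : ℂ) (w (e.1 (topMatIdx n))) * coeff e.1 (q l)) :=
        MvPolynomial.algHom_ext fun e => by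
          simp only [AlgHom.comp_apply, aeval_X, Polynomial.coe_aeval_eq_eval, Polynomial.eval_mul,
            Polynomial.eval_C]
      have h := congrArg (fun φ => φ (F i)) H
      simpa only [AlgHom.comp_apply, Polynomial.coe_aeval_eq_eval] using h
    rw [hcomp]
    -- pull `(j!)^δ` through the homogeneous `F_i`
    have hsm := algHom_apply_eq_pow_smul_of_isHomogeneous
      (MvPolynomial.aeval (fun e : DegIdx (MatIdx n) n =>
        (((e.1 (topMatIdx n) + j).descFactorial j : ℕ) : ℂ) * coeff e.1 (q l)))
      (MvPolynomial.aeval (fun e : DegIdx (MatIdx n) n =>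
        Polynomial.eval (j : ℂ) (w (e.1 (topMatIdx n))) * coeff e.1 (q l)))
      ((j.factorial : ℂ)) (fun e => by
        rw [aeval_X, aeval_X, smul_eq_mul, ← mul_assoc, factorial_mul_eval_twistPoly]) (hhom i)
    rw [hsm, smul_eq_mul]
  · -- degree bound: `deg w_e = e ≤ n`, so entries have degree `≤ δ·n`
    have hw : ∀ e : ℕ, (w e).natDegree ≤ e := by
      intro e
      have h1 : (∏ i ∈ Finset.range e, (Polynomial.X + Polynomial.C ((i : ℂ) + 1))).natDegree ≤ e := by
        refine (Polynomial.natDegree_prod_le _ _).trans ?_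
        refine (Finset.sum_le_sum (f := fun i : ℕ => (Polynomial.X + Polynomial.C ((i : ℂ) + 1)).natDegree)
          (g := fun _ => 1) fun i _ => ?_).trans ?_
        · exact (Polynomial.natDegree_X_add_C _).le
        · simp
      exact (Polynomial.natDegree_C_mul_le _ _).trans h1
    simp only [P, Matrix.of_apply]
    refine natDegree_aeval_le_of_isHomogeneous (hhom i) _ fun e => ?_
    refine (Polynomial.natDegree_mul_le).trans ?_
    rw [Polynomial.natDegree_C, add_zero]
    refine (hw _).trans ?_
    have he := mem_degMonomials_iff.mp e.2
    rw [Finsupp.degree_eq_sum] at he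
    calc e.1 (topMatIdx n) ≤ ∑ x, e.1 x :=
          Finset.single_le_sum (f := fun x => e.1 x) (fun _ _ => Nat.zero_le _) (Finset.mem_univ _)
      _ = n := he

/-- **A nonsingular untwisted matrix stays nonsingular after twisting, off at most `D·nδ` paddings.**
If the UNTWISTED evaluation matrix `(F_i(q_l))` of forms `F_i` of degree `δ` at degree-`n` forms `q_l` is
nonsingular, then the Δ_j-twisted matrices are nonsingular for all `j` outside a set of at most `D·(n·δ)`
natural numbers (the natural roots of `det P`, `P` the polynomial matrix of `exists_twistPolyMatrix`).
[this crux] -/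
theorem twistedDet_ne_zero_cofinite (n : ℕ) [NeZero n] {δ D : ℕ} (F : Fin D → MvPolynomial (DegIdx (MatIdx n) n) ℂ)
    (hhom : ∀ i, (F i).IsHomogeneous δ) (q : Fin D → MvPolynomial (MatIdx n) ℂ)
    (hdet : (Matrix.of fun i l : Fin D => MvPolynomial.aeval (formCoeff n (q l)) (F i)).det ≠ 0) :
    ∃ E : Finset ℕ, E.card ≤ D * (n * δ) ∧ ∀ j : ℕ, j ∉ E →
      (Matrix.of fun i l : Fin D => MvPolynomial.aeval
          (fun e : DegIdx (MatIdx n) n => (((e.1 (topMatIdx n) + j).descFactorial j : ℕ) : ℂ) *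
            MvPolynomial.coeff e.1 (q l)) (F i)).det ≠ 0 := by
  classical
  obtain ⟨P, hspec, hdegP⟩ := exists_twistPolyMatrix n F hhom q
  -- at `t = 0` the specialisation is the untwisted matrix
  have hzero : (Matrix.of fun i l : Fin D => MvPolynomial.aeval (formCoeff n (q l)) (F i)) =
      P.map (Polynomial.eval ((0 : ℕ) : ℂ)) := by
    have h := hspec 0
    simp only [Nat.add_zero, Nat.descFactorial_zero, Nat.cast_one, one_mul, Nat.factorial_zero, one_pow,
      one_smul] at h
    rw [← h]
    rfl
  have hdetmap : ∀ x : ℂ, (P.map (Polynomial.eval x)).det = Polynomial.eval x P.det := fun x => by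
    rw [← Polynomial.coe_evalRingHom, ← RingHom.mapMatrix_apply, ← RingHom.map_det]
  have hdetP : P.det ≠ 0 := by
    intro h0
    apply hdet
    rw [hzero, hdetmap, h0, Polynomial.eval_zero]
  have hdeg : P.det.natDegree ≤ D * (n * δ) := by
    have := natDegree_det_le_of_forall_le P hdegP
    rw [Nat.mul_comm δ n] at this
    exact this
  refine ⟨(P.det.roots.toFinset).preimage (fun j : ℕ => (j : ℂ)) (Nat.cast_injective.injOn), ?_, ?_⟩
  · rw [Finset.card_preimage]
    refine (Finset.card_filter_le _ _).trans ?_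
    refine (Multiset.toFinset_card_le _).trans ?_
    exact (Polynomial.card_roots' _).trans hdeg
  · intro j hj
    have hroot : Polynomial.eval (j : ℂ) P.det ≠ 0 := by
      intro h0
      apply hj
      rw [Finset.mem_preimage, Multiset.mem_toFinset, Polynomial.mem_roots hdetP]
      exact h0
    rw [hspec j, Matrix.det_smul, Fintype.card_fin, hdetmap]
    exact mul_ne_zero (pow_ne_zero _ (pow_ne_zero _ (Nat.cast_ne_zero.2 (Nat.factorial_ne_zero j)))) hroot

/-- Eventual form of `twistedDet_ne_zero_cofinite`: nonsingular for all `j ≥ j₀`. [this crux] -/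
theorem twistedDet_ne_zero_eventually (n : ℕ) [NeZero n] {δ D : ℕ} (F : Fin D → MvPolynomial (DegIdx (MatIdx n) n) ℂ)
    (hhom : ∀ i, (F i).IsHomogeneous δ) (q : Fin D → MvPolynomial (MatIdx n) ℂ)
    (hdet : (Matrix.of fun i l : Fin D => MvPolynomial.aeval (formCoeff n (q l)) (F i)).det ≠ 0) :
    ∃ j₀ : ℕ, ∀ j : ℕ, j₀ ≤ j →
      (Matrix.of fun i l : Fin D => MvPolynomial.aeval
          (fun e : DegIdx (MatIdx n) n => (((e.1 (topMatIdx n) + j).descFactorial j : ℕ) : ℂ) *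
            MvPolynomial.coeff e.1 (q l)) (F i)).det ≠ 0 := by
  obtain ⟨E, -, hE⟩ := twistedDet_ne_zero_cofinite n F hhom q hdet
  refine ⟨E.sup id + 1, fun j hj => hE j fun hjE => ?_⟩
  have := Finset.le_sup (f := id) hjE
  simp only [id_eq] at this
  omega

end

end Summit.ValiantsHypothesis.ValiantsHypothesis.Theorems.ValuativeFlip
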